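import Literature.NumberTheory.EllipticCurves.ModularCurveRealPeriodProofs
import HarnessLib

/-!
# BirchSwinnertonDyer / LeadingTerm — crux `TamePinchR` (stmt-BirchSwinnertonDyer-17007),
# line `Sketch`, stub **D** `stub_maninPeriodCofinite`

Registered stub **D** of the skeleton `Cruxes/TamePinchR/Lines/Sketch.lean`: for a modular
parametrisation datum `D` of an elliptic curve `W/ℚ` (newform `f = D.f`, Manin constant
`c = D.maninConstant`), for all primes `p` outside a finite set both hypotheses of C.-H. Kim's
certificate at `p` hold: `p ∤ c`, and the Néron real period `Ω(W) = W.realPeriodRat` is a rational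
`p`-adic unit multiple of the real period `Ω⁺_f = plusPeriod D.f` of the newform.

Proof: `c ≠ 0` (`maninConstant_ne_zero_holds`, Edixhoven 1991 §1) and the period relation
`m · Ω(W) = |c| · Ω⁺_f` with `0 < m` (`realPeriodRat_dvd_holds`, Edixhoven 1991 §1; Cremona §2.8,
§2.10). Take `S` = the prime factors of `|c| · m` and `u = |c| / m ∈ ℚ`: for a prime `p ∉ S`,
`p ∤ |c|` and `p ∤ m`, so `p ∤ c` and `‖u‖_p = ‖|c|‖_p / ‖m‖_p = 1` (an integer prime to `p` has
`p`-adic norm `1`), while `Ω(W) = u · Ω⁺_f` is the period relation divided by `m > 0`.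
-/

set_option linter.dupNamespace false

noncomputable section

namespace Summit.BirchSwinnertonDyer.BirchSwinnertonDyer.Theorems

open scoped MatrixGroups ModularForm Classical
open CongruenceSubgroup Literature.NumberTheory.EllipticCurves
  Literature.NumberTheory.EllipticCurves.ModularForms WeierstrassCurve

/-- A natural number not divisible by the prime `p` has `p`-adic norm `1` in `ℚ_[p]`
(Gouvêa, *p-adic Numbers*, §3.3). [folklore] -/
theorem stubD_padicNorm_natCast_eq_one {p : ℕ} [Fact p.Prime] {n : ℕ} (h : ¬ p ∣ n) :
    ‖(n : ℚ_[p])‖ = 1 :=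
  Padic.norm_natCast_eq_one_iff.mpr ((Nat.Prime.coprime_iff_not_dvd Fact.out).mpr h)

/-- Stub **D** (Manin constant and period transfer are `p`-adic units for almost all `p`). For a
modular parametrisation datum `D` of `W` with Manin constant `c ≠ 0`
(`maninConstant_ne_zero_holds`) and period relation `m · Ω(W) = |c| · Ω⁺_f`, `0 < m`
(`realPeriodRat_dvd_holds`), every prime `p ∤ |c| · m` satisfies `p ∤ c` and
`Ω(W) = u · Ω⁺_f` with `u = |c|/m ∈ ℚ`, `‖u‖_p = 1` (Edixhoven 1991, §1; Cremona 1997, §2.8 and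
§2.10). [cite: EdixhovenManin1991, §1] -/
theorem stub_maninPeriodCofinite :
    ∀ (W : WeierstrassCurve ℚ) [W.IsElliptic] [W.IsGloballyMinimal] {N : ℕ} [NeZero N]
      (D : ModularParametrizationData W N),
      ∃ S : Finset ℕ, ∀ p ∉ S, ∀ _ : Fact p.Prime, ¬ (p : ℤ) ∣ D.maninConstant ∧
        ∃ u : ℚ, ‖(u : ℚ_[p])‖ = 1 ∧ W.realPeriodRat = u * plusPeriod D.f := by
  intro W _ _ N _ D
  obtain ⟨m, hm, hmeq⟩ := D.realPeriodRat_dvd_holds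
  have hc : D.maninConstant ≠ 0 := D.maninConstant_ne_zero_holds
  refine ⟨(D.maninConstant.natAbs * m).primeFactors, fun p hp hpp ↦ ?_⟩
  have hne : D.maninConstant.natAbs * m ≠ 0 := mul_ne_zero (Int.natAbs_ne_zero.mpr hc) hm.ne'
  have hndvd : ¬ p ∣ D.maninConstant.natAbs * m := fun h ↦
    hp (Nat.mem_primeFactors.mpr ⟨hpp.out, h, hne⟩)
  have hpc : ¬ p ∣ D.maninConstant.natAbs := fun h ↦ hndvd (h.mul_right m)
  have hpm : ¬ p ∣ m := fun h ↦ hndvd (h.mul_left _)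
  refine ⟨fun h ↦ hpc (Int.natCast_dvd.mp h), (D.maninConstant.natAbs : ℚ) / m, ?_, ?_⟩
  · have hcast : (((D.maninConstant.natAbs : ℚ) / m : ℚ) : ℚ_[p]) =
        (D.maninConstant.natAbs : ℚ_[p]) / (m : ℚ_[p]) := by
      push_cast
      rfl
    rw [hcast, norm_div, stubD_padicNorm_natCast_eq_one hpc, stubD_padicNorm_natCast_eq_one hpm,
      div_one]
  · have hcast : (((D.maninConstant.natAbs : ℚ) / m : ℚ) : ℝ) =
        |(D.maninConstant : ℝ)| / (m : ℝ) := by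
      rw [Rat.cast_div, Rat.cast_natCast, Rat.cast_natCast, Nat.cast_natAbs, Int.cast_abs]
    rw [hcast, div_mul_eq_mul_div, ← hmeq, mul_div_cancel_left₀ _ (Nat.cast_pos.mpr hm).ne']

end Summit.BirchSwinnertonDyer.BirchSwinnertonDyer.Theorems

end
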